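import Summits.QuantumFields.YangMills.Theorems.LangevinControlUVFemtoCurvatureSkewnessCMadicDescent
import Summits.QuantumFields.YangMills.Theorems.FemtoCurvatureSkewnessC.Negative.ContinuityContent

/-!
# Crux `FemtoCurvatureSkewnessC` (stmt-QuantumFields-16205), line `ratio-transport`: per-step ⇒ two-ended; skeleton v4.1's assembly

Lead `prover-line-stmt-QuantumFields-16205-c1-0` (line lead, cycle 2, 2026-08-16).  Second companion proof file of the vocabulary (D)
`LangevinControlUVFemtoCurvatureSkewnessCRatioTransportDefsD.lean` (p126481).  Theorems only, no `sorry`, nothing posited; inputs: the landed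
cutoff chain `cut_chain` (p123392), the M-adic two-ended descent `ratioFloor_of_twoEnded` (`…CMadicDescent.lean`), the landed intermediate
value helper `exists_later_level'` (`Theorems/FemtoCurvatureSkewnessC/Negative/ContinuityContent.lean`, p122377), `signedRigidity_of_ratioFloor`
(p123064), `skewnessPackage_of_signedRigidity`, `femtoCurvatureSkewnessC_iff` (landed).

* § Weakening — `cutoffTwoEnded_of_cutoffTransport`: the per-step summable dyadic transport of a continuous positive map `a → 0` implies the
  two-ended transport with block factor `2` (intermediate couplings by the intermediate value theorem between the coarse and the fine
  coupling; the degenerate case `k = 0`, `β' ≠ β`, `a β' = a β` — possible for a non-injective map — is settled through the common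
  refinement `(2L, β⁺, 2n)`, `2a(β⁺) = a β`); `cutoffEngineTE_of_cutoffEngine : CutoffEngine → CutoffEngineTE` (v4's E_c ⇒ v4.1's E_c;
  `a → 0` by domination under the package map).
* § Assembly — `femtoCurvatureSkewnessC_of_enginesTE : CutoffEngineTE → VolumeEngine → SeparationEngine → Anchors → FemtoCurvatureSkewnessC`
  (the served crux BY NAME modulo the four stubs of skeleton v4.1 — CONDITIONAL, nothing asserted; output map = hypothesis map).
-/

set_option autoImplicit false

noncomputable section

namespace Summit.QuantumFields.YangMills.Cruxes.FemtoCurvatureSkewnessC.RatioTransport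

open MeasureTheory Filter Topology
open scoped BigOperators
open Literature.MathematicalPhysics.QuantumFieldTheory
open Summit.QuantumFields.YangMills.Theorems.FemtoCurvatureSkewness.Negative (TwoPointPackage SkewnessPackage)
open Summit.QuantumFields.YangMills.Cruxes.FemtoCurvatureSkewness.CouplingCubicResponse
  (SignedRigidity skewnessPackage_of_signedRigidity)
open Summit.QuantumFields.YangMills.Theses.LangevinControlUV (FemtoCurvatureSkewnessC)
open Summit.QuantumFields.YangMills.Theorems.FemtoCurvatureSkewness (femtoCurvatureSkewnessC_iff)
open Summit.QuantumFields.YangMills.Theorems.FemtoCurvatureSkewnessC.Negative (exists_later_level')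

section Weakening

variable {G : Type} [Group G] [TopologicalSpace G] [IsTopologicalGroup G] [CompactSpace G]
  [MeasurableSpace G] [BorelSpace G]

/-- `skewRatioT` does not depend on the `NeZero` instance term: equal data give equal ratios (proof irrelevance). -/
theorem skewRatioT_congr (r : LatticeRep G) {L L' : ℕ} [NeZero L] [NeZero L'] (hL : L = L') {β β' : ℝ}
    (hβ : β = β') {n n' : ℕ} (hn : n = n') : skewRatioT r L β n = skewRatioT r L' β' n' := by
  subst hL hβ hn; rfl

/-- **Per-step summable dyadic transport ⇒ two-ended transport with block factor `2`**, for a continuous positive map tending to `0`. -/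
theorem cutoffTwoEnded_of_cutoffTransport (r : LatticeRep G) {a : ℝ → ℝ} (hpos : ∀ β, 0 < a β) (hcont : Continuous a)
    (hat : Tendsto a atTop (𝓝 0)) (h : CutoffTransport r a) : CutoffTwoEnded r a 2 := by
  obtain ⟨βc, ℓc, ε, hℓc, hsum, hstep⟩ := h
  intro δ hδ
  obtain ⟨N₀, hN₀, hsumN⟩ := hsum (δ / 2) (by positivity)
  refine ⟨βc, ℓc, N₀, hℓc, hN₀, ?_⟩
  intro L L₀ _ _ k n₀ β β' hL hn₀ h8 hβc' hβ'β hfem haβ'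
  have hn₀1 : 1 ≤ n₀ := hN₀.trans hn₀
  have hL₀pos : 0 < L₀ := by omega
  have hδ2 : ∑ i ∈ Finset.range k, ε (2 ^ i * n₀) ≤ δ / 2 := hsumN n₀ k hn₀
  have haβ'' : a β' = a β * 2 ^ k := by rw [haβ']; push_cast; ring
  rcases Nat.eq_zero_or_pos k with hk0 | hkpos
  · -- `k = 0`: the two points share `L`, `n` and the value of `a`; compare both with the common refinement `(2L, β⁺, 2n)`
    subst hk0
    have hLL : L = L₀ := by rw [hL, pow_zero, one_mul]
    have haa : a β' = a β := by rw [haβ'', pow_zero, mul_one]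
    obtain ⟨βp, -, hβp⟩ := exists_later_level' hcont hat β (half_pos (hpos β)) (half_lt_self (hpos β))
    have h2 : 2 * a βp = a β := by rw [hβp]; ring
    have h2' : 2 * a βp = a β' := by rw [haa, h2]
    haveI : NeZero (2 * L) := ⟨by omega⟩
    have hfemβ' : (L : ℝ) * a β' ≤ ℓc := by rw [haa]; exact hfem
    have h8L : 8 * n₀ ≤ L := hLL ▸ h8
    have s1 := hstep L (2 * L) β βp n₀ (hβc'.trans hβ'β) hfem hn₀1 h8L rfl h2
    have s2 := hstep L (2 * L) β' βp n₀ hβc' hfemβ' hn₀1 h8L rfl h2'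
    have hε : ε n₀ ≤ δ / 2 := by simpa using hsumN n₀ 1 hn₀
    rw [skewRatioT_congr r (rfl : L = L) (rfl : β = β) (show 2 ^ 0 * n₀ = n₀ by rw [pow_zero, one_mul]),
      skewRatioT_congr r hLL.symm (rfl : β' = β') (rfl : n₀ = n₀)]
    calc |skewRatioT r L β n₀ - skewRatioT r L β' n₀|
        = |(skewRatioT r (2 * L) βp (2 * n₀) - skewRatioT r L β' n₀) -
            (skewRatioT r (2 * L) βp (2 * n₀) - skewRatioT r L β n₀)| := by ring_nf
      _ ≤ |skewRatioT r (2 * L) βp (2 * n₀) - skewRatioT r L β' n₀| +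
            |skewRatioT r (2 * L) βp (2 * n₀) - skewRatioT r L β n₀| := abs_sub _ _
      _ ≤ ε n₀ + ε n₀ := add_le_add s2 s1
      _ ≤ δ := by linarith
  · -- `k ≥ 1`: a chain with top `β`, bottom `β'`, intermediate couplings by the intermediate value theorem on `[β', β]`
    have hk0 : k ≠ 0 := by omega
    have hIVT : ∀ i : ℕ, ∃ b : ℝ, (i ≤ k → βc ≤ b ∧ a b = a β * 2 ^ (k - i)) ∧ (i = 0 → b = β') ∧ (i = k → b = β) := by
      intro i
      by_cases hi0 : i = 0
      · subst hi0
        exact ⟨β', fun _ => ⟨hβc', by rw [haβ'', Nat.sub_zero]⟩, fun _ => rfl, fun h => (hk0 h.symm).elim⟩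
      by_cases hik : i = k
      · subst hik
        exact ⟨β, fun _ => ⟨hβc'.trans hβ'β, by rw [Nat.sub_self, pow_zero, mul_one]⟩, fun h => (hi0 h).elim,
          fun _ => rfl⟩
      by_cases hi : i ≤ k
      · have hlow : a β ≤ a β * 2 ^ (k - i) :=
          le_mul_of_one_le_right (hpos β).le (one_le_pow₀ (by norm_num))
        have hup : a β * 2 ^ (k - i) ≤ a β' := by
          rw [haβ'']
          exact mul_le_mul_of_nonneg_left (pow_le_pow_right₀ (by norm_num) (Nat.sub_le k i)) (hpos β).le
        obtain ⟨b, ⟨hb1, -⟩, hab⟩ := intermediate_value_Icc' hβ'β hcont.continuousOn ⟨hlow, hup⟩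
        exact ⟨b, fun _ => ⟨hβc'.trans hb1, hab⟩, fun h => (hi0 h).elim, fun h => (hik h).elim⟩
      · exact ⟨0, fun h => (hi h).elim, fun h => (hi0 h).elim, fun h => (hik h).elim⟩
    choose βj hβj hβj0 hβjk using hIVT
    have hfemto : (2 : ℝ) ^ k * L₀ * a β ≤ ℓc := by
      have : ((2 ^ k * L₀ : ℕ) : ℝ) * a β ≤ ℓc := hL ▸ hfem
      push_cast at this
      exact this
    have hC := cut_chain r a hstep L₀ n₀ k hL₀pos h8 hn₀1 β βj (fun i hi => hβj i hi) hfemto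
    rw [hβjk k rfl, hβj0 0 rfl] at hC
    rw [skewRatioT_congr r hL rfl (rfl : 2 ^ k * n₀ = 2 ^ k * n₀),
      skewRatioT_congr r (show L₀ = 2 ^ 0 * L₀ by rw [pow_zero, one_mul]) (rfl : β' = β')
        (show n₀ = 2 ^ 0 * n₀ by rw [pow_zero, one_mul])]
    exact hC.trans (hδ2.trans (by linarith))

omit [Group G] [TopologicalSpace G] [IsTopologicalGroup G] [CompactSpace G] [MeasurableSpace G] [BorelSpace G] in
/-- A positive map dominated by a map tending to `0` tends to `0`. -/
theorem tendsto_zero_of_dominated {a a₀ : ℝ → ℝ} (hpos : ∀ β, 0 < a β) (hdom : Dominated a a₀)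
    (ha₀ : Tendsto a₀ atTop (𝓝 0)) : Tendsto a atTop (𝓝 0) := by
  obtain ⟨K, β₃, hK, hKβ⟩ := hdom
  have hup : Tendsto (fun β => K * a₀ β) atTop (𝓝 0) := by simpa using ha₀.const_mul K
  refine tendsto_of_tendsto_of_tendsto_of_le_of_le' tendsto_const_nhds hup
    (Eventually.of_forall fun β => (hpos β).le) ?_
  filter_upwards [eventually_ge_atTop β₃] with β hβ using hKβ β hβ

/-- **v4's E_c ⇒ v4.1's E_c**: the per-step dyadic cutoff engine implies the two-ended engine (block factor `2`, same map). -/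
theorem cutoffEngineTE_of_cutoffEngine (h : CutoffEngine) : CutoffEngineTE := by
  intro G _ _ _ _ _ _ hG r a₀ ha₀ hP₀
  obtain ⟨a, ha, hpos, hdom, hc⟩ := h G hG r a₀ ha₀ hP₀
  obtain ⟨Γ, β₀, ℓ₀, c, C, -, -, -, ha₀0, -⟩ := id hP₀
  exact ⟨2, le_rfl, a, ha, hpos, hdom,
    cutoffTwoEnded_of_cutoffTransport r hpos ha (tendsto_zero_of_dominated hpos hdom ha₀0) hc⟩

end Weakening

/-! ## § Assembly — skeleton v4.1 closes the served crux modulo E_c (two-ended), E_v, E_s and A -/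

/-- **Signed rigidity in the femto boxes of the hypothesis map** from the two-ended cutoff engine, the volume and separation engines and
the anchors (floor by `ratioFloor_of_twoEnded`, rigidity by `a₀`'s own package). -/
theorem signedRigidity_of_enginesTE {G : Type} [Group G] [TopologicalSpace G] [IsTopologicalGroup G] [CompactSpace G]
    [MeasurableSpace G] [BorelSpace G] (hG : IsCompactSimpleLieGroup G) (hc : CutoffEngineTE) (hv : VolumeEngine)
    (hs : SeparationEngine) (r : LatticeRep G) (hA : FixedTorusAnchors r) {a₀ : ℝ → ℝ} (ha₀ : Continuous a₀)
    (hP₀ : TwoPointPackage r a₀) : SignedRigidity r a₀ := by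
  obtain ⟨M, hM, a, ha, hpos, hdom, hcut⟩ := hc G hG r a₀ ha₀ hP₀
  obtain ⟨Γ, β₀, ℓ₀, c, C, -, -, hpos₀, -, -⟩ := id hP₀
  exact signedRigidity_of_ratioFloor r hP₀
    (ratioFloor_of_twoEnded r a a₀ hM hpos ha hpos₀ hdom hA hcut (hv G hG r a₀ ha₀ hP₀) (hs G hG r a₀ ha₀ hP₀))

/-- **Skeleton v4.1's composition: the line `ratio-transport` closes the served crux BY NAME modulo exactly E_c (two-ended), E_v, E_s
and A** (CONDITIONAL on the four route-posited stubs; nothing asserted).  Output map = the hypothesis map. -/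
theorem femtoCurvatureSkewnessC_of_enginesTE (hc : CutoffEngineTE) (hv : VolumeEngine) (hs : SeparationEngine) (hA : Anchors) :
    FemtoCurvatureSkewnessC := by
  rw [femtoCurvatureSkewnessC_iff]
  intro G _ _ _ _ hG
  letI : MeasurableSpace G := borel G
  haveI : BorelSpace G := ⟨rfl⟩
  intro r hex
  obtain ⟨a₀, ha₀, hP₀⟩ := hex
  exact ⟨a₀, ha₀, hP₀, skewnessPackage_of_signedRigidity r hP₀
    (signedRigidity_of_enginesTE hG hc hv hs r (hA G hG r ⟨a₀, ha₀, hP₀⟩) ha₀ hP₀)⟩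

end Summit.QuantumFields.YangMills.Cruxes.FemtoCurvatureSkewnessC.RatioTransport

end
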